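import Literature.InformationTheory.QuantumCodes.QuantumExpanderCriticalGeneratorsExist
import Literature.InformationTheory.QuantumCodes.QuantumExpanderSyndromeDecrease
import HarnessLib

/-!
# Quantum expander codes: the reduced-cardinality (weighted-size) argument of Fawzi–Grospellier–Leverrier
# 2018 Lemma 24 and its elementary inequality — PROOF

Topic `Literature/InformationTheory/QuantumCodes` (venture QEC; small-set-flip analysis, step 3 of 4).
Source: FGL18 = arXiv:1711.08351v2, §7.1: Lemma 24 and its proof (p0018 L36-130) — the "reduced
cardinality" `‖E‖ = |E∩A²|/d_B + |E∩B²|/d_A` (kept integral as `wnorm = Δ_A|E∩A²| + Δ_B|E∩B²|`), the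
minimiser `E_R` of `‖·‖` over `E + C_Z^⊥`, "`x + y ≤ 1` because `E_R` minimizes `‖E_R‖`", the inequality
`d_A‖E‖ ≤ |E| ≤ d_B‖E‖` (valid for `d_A ≤ d_B`, the source's convention), the function analysis
`f(x,y) ≥ β/r`; LTZ15 = arXiv:1504.00822v1, Lemma 8 (p0008 L104-110).

* `wnorm_add_row` — adding the generator `g_{ba}` changes `Δ_AΔ_B‖E‖` by `2Δ_AΔ_B − 2(Δ_A m_A + Δ_B m_B)`
  (`m_A`, `m_B` = error qubits of the generator), whence `Δ_A|x_a| + Δ_B|x_b| ≤ Δ_AΔ_B` at a minimiser;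
* `hammingNorm_le_wnorm` — `Δ_A|E| ≤ Δ_AΔ_B‖E‖ ≤ Δ_B|E|`; `exists_wnorm_min` — a minimiser exists;
* `triangle_ineq`, `key_ineq` — the elementary inequality (`(s+½)²x + (s−½)²y ≥ xy` on `x + y ≤ 1`) and
  the resulting arithmetic `decrease ≥ β₀Δ_B(|x_a| + |x_b|)`;
The assembly of Lemma 24 itself (`exists_smallSet_decrease`) and Proposition 11 are in
`QuantumExpanderSmallSetFlip.lean`.
-/

namespace Literature.InformationTheory.QuantumCodes

namespace QuantumExpander

open Finset Matrix

variable {A B : Type*} [Fintype A] [Fintype B] [DecidableEq A] [DecidableEq B]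

/-- In `𝔽₂` a non-zero element is `1`. [folklore] -/
private theorem zmod2_eq_one_of_ne_zero {z : ZMod 2} (h : z ≠ 0) : z = 1 := by
  revert z; decide

section ReducedCardinality

omit [Fintype A] [Fintype B] in
/-- The generator `g_{ba}` (row `(b, a)` of `H_Z`) as a vector: value `H b α·[a' = a]` on `αa'` and
`[b' = b]·H β a` on `b'β`. [cite: LeverrierTillichZemor2015, §3 eq. (g_ba) (arXiv v1 p0007)] -/
theorem expanderHZ_row_apply_inl (H : Matrix B A (ZMod 2)) (b : B) (a : A) (α a' : A) :
    expanderHZ H (b, a) (Sum.inl (α, a')) = H b α * (if a = a' then 1 else 0) := by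
  simp [expanderHZ, HypergraphProduct.xMatrix_apply_inl]

omit [Fintype A] [Fintype B] in
/-- Second half of the entry formula of the generator row. [cite: LeverrierTillichZemor2015, §3 eq. (g_ba) (arXiv v1 p0007)] -/
theorem expanderHZ_row_apply_inr (H : Matrix B A (ZMod 2)) (b : B) (a : A) (b' : B) (β : B) :
    expanderHZ H (b, a) (Sum.inr (b', β)) = (if b = b' then 1 else 0) * H β a := by
  simp [expanderHZ, HypergraphProduct.xMatrix_apply_inr, Matrix.transpose_apply]

/-- A generator is harmless: the row `(b,a)` of `H_Z` lies in `rowsp H_Z`.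
[cite: FawziGrospellierLeverrier2018, §2.3 (E ⊕ g is equivalent to E)] -/
theorem expanderHZ_row_mem_rowSpace (H : Matrix B A (ZMod 2)) (b : B) (a : A) :
    (expanderHZ H (b, a) : (A × A) ⊕ (B × B) → ZMod 2) ∈ rowSpace (expanderHZ H) := by
  rw [mem_rowSpace_iff]
  exact ⟨Pi.single (b, a) 1, Matrix.single_one_vecMul _ _⟩

omit [Fintype B] [DecidableEq A] [DecidableEq B] in
/-- The `A²`-count of a vector as a sum over the second coordinate of column counts. [folklore] -/
private theorem cardA_eq_sum (w : (A × A) ⊕ (B × B) → ZMod 2) :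
    ((univ.filter fun p : A × A => w (Sum.inl p) ≠ 0).card : ℕ)
      = ∑ a' : A, (univ.filter fun α : A => w (Sum.inl (α, a')) ≠ 0).card := by
  rw [Finset.card_filter]
  simp_rw [Finset.card_filter]
  rw [Fintype.sum_prod_type_right]

omit [Fintype A] [DecidableEq A] [DecidableEq B] in
/-- The `B²`-count of a vector as a sum over the first coordinate of row counts. [folklore] -/
private theorem cardB_eq_sum (w : (A × A) ⊕ (B × B) → ZMod 2) :
    ((univ.filter fun p : B × B => w (Sum.inr p) ≠ 0).card : ℕ)
      = ∑ b' : B, (univ.filter fun β : B => w (Sum.inr (b', β)) ≠ 0).card := by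
  rw [Finset.card_filter]
  simp_rw [Finset.card_filter]
  rw [Fintype.sum_prod_type]

/-- Adding a generator to an error: on the column `a` of `A²` the number of error qubits `αa` changes from
`m_A + r` to `(Δ_B − m_A) + r`, where `m_A = |{α ∈ Γ(b) : αa ∈ E}|` (inside the generator the errors are
complemented). [cite: FawziGrospellierLeverrier2018, Lemma 24 proof (E_R minimises ‖·‖ over E + C_Z^⊥; arXiv v2 p0018 L44-50, L81)] -/
theorem cardA_add_row (H : Matrix B A (ZMod 2)) {dA dB : ℕ} (hreg : IsBiregular H dA dB)
    (v : (A × A) ⊕ (B × B) → ZMod 2) (b : B) (a : A) :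
    (univ.filter fun p : A × A => (v + expanderHZ H (b, a)) (Sum.inl p) ≠ 0).card
      + 2 * ((nbrs Hᵀ b).filter fun α => v (Sum.inl (α, a)) ≠ 0).card
      = (univ.filter fun p : A × A => v (Sum.inl p) ≠ 0).card + dB := by
  classical
  rw [cardA_eq_sum, cardA_eq_sum]
  -- only the column `a` changes
  have hoff : ∀ a', a' ≠ a →
      (univ.filter fun α : A => (v + expanderHZ H (b, a)) (Sum.inl (α, a')) ≠ 0).card
        = (univ.filter fun α : A => v (Sum.inl (α, a')) ≠ 0).card := by
    intro a' hne
    congr 1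
    refine Finset.filter_congr fun α _ => ?_
    rw [Pi.add_apply, expanderHZ_row_apply_inl, if_neg (Ne.symm hne), mul_zero, add_zero]
  rw [← Finset.add_sum_erase _ _ (Finset.mem_univ a), ← Finset.add_sum_erase _ _ (Finset.mem_univ a)]
  have hsum : ∑ a' ∈ univ.erase a,
      (univ.filter fun α : A => (v + expanderHZ H (b, a)) (Sum.inl (α, a')) ≠ 0).card
      = ∑ a' ∈ univ.erase a, (univ.filter fun α : A => v (Sum.inl (α, a')) ≠ 0).card :=
    Finset.sum_congr rfl fun a' ha' => hoff a' (Finset.ne_of_mem_erase ha')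
  rw [hsum]
  -- the column `a`: split over `Γ(b)` and its complement
  set S := nbrs Hᵀ b with hS
  have hcol : ∀ (w : (A × A) ⊕ (B × B) → ZMod 2),
      (univ.filter fun α : A => w (Sum.inl (α, a)) ≠ 0).card
        = (S.filter fun α => w (Sum.inl (α, a)) ≠ 0).card
          + (Sᶜ.filter fun α => w (Sum.inl (α, a)) ≠ 0).card := by
    intro w
    rw [← Finset.card_union_of_disjoint]
    · congr 1
      ext α
      simp only [Finset.mem_filter, Finset.mem_univ, true_and, Finset.mem_union, Finset.mem_compl]
      tauto
    · exact Finset.disjoint_filter_filter disjoint_compl_right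
  rw [hcol (v + expanderHZ H (b, a)), hcol v]
  -- outside `Γ(b)` the generator vanishes
  have hout : (Sᶜ.filter fun α => (v + expanderHZ H (b, a)) (Sum.inl (α, a)) ≠ 0)
      = Sᶜ.filter fun α => v (Sum.inl (α, a)) ≠ 0 := by
    refine Finset.filter_congr fun α hα => ?_
    rw [Finset.mem_compl, hS, mem_nbrs, Matrix.transpose_apply, not_not] at hα
    rw [Pi.add_apply, expanderHZ_row_apply_inl, hα, zero_mul, add_zero]
  rw [hout]
  -- inside `Γ(b)` the generator is `1`: errors are complemented
  have hin : (S.filter fun α => (v + expanderHZ H (b, a)) (Sum.inl (α, a)) ≠ 0)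
      = S.filter fun α => ¬ (v (Sum.inl (α, a)) ≠ 0) := by
    refine Finset.filter_congr fun α hα => ?_
    rw [hS, mem_nbrs, Matrix.transpose_apply] at hα
    rw [Pi.add_apply, expanderHZ_row_apply_inl, if_pos rfl, mul_one, zmod2_eq_one_of_ne_zero hα, not_not]
    constructor
    · intro h
      by_contra hv
      exact h (by rw [zmod2_eq_one_of_ne_zero hv]; decide)
    · intro h; rw [h]; decide
  rw [hin]
  have hsplit := Finset.card_filter_add_card_filter_not (s := S) (fun α => v (Sum.inl (α, a)) ≠ 0)
  have hScard : S.card = dB := card_nbrs_transpose_eq H hreg b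
  omega

/-- The `B²` counterpart of `cardA_add_row` (row `b` of `B²`, generator part `{bβ : β ∼ a}`).
[cite: FawziGrospellierLeverrier2018, Lemma 24 proof (arXiv v2 p0018 L44-50, L81)] -/
theorem cardB_add_row (H : Matrix B A (ZMod 2)) {dA dB : ℕ} (hreg : IsBiregular H dA dB)
    (v : (A × A) ⊕ (B × B) → ZMod 2) (b : B) (a : A) :
    (univ.filter fun p : B × B => (v + expanderHZ H (b, a)) (Sum.inr p) ≠ 0).card
      + 2 * ((nbrs H a).filter fun β => v (Sum.inr (b, β)) ≠ 0).card
      = (univ.filter fun p : B × B => v (Sum.inr p) ≠ 0).card + dA := by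
  classical
  rw [cardB_eq_sum, cardB_eq_sum]
  have hoff : ∀ b', b' ≠ b →
      (univ.filter fun β : B => (v + expanderHZ H (b, a)) (Sum.inr (b', β)) ≠ 0).card
        = (univ.filter fun β : B => v (Sum.inr (b', β)) ≠ 0).card := by
    intro b' hne
    congr 1
    refine Finset.filter_congr fun β _ => ?_
    rw [Pi.add_apply, expanderHZ_row_apply_inr, if_neg (Ne.symm hne), zero_mul, add_zero]
  rw [← Finset.add_sum_erase _ _ (Finset.mem_univ b), ← Finset.add_sum_erase _ _ (Finset.mem_univ b)]
  have hsum : ∑ b' ∈ univ.erase b,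
      (univ.filter fun β : B => (v + expanderHZ H (b, a)) (Sum.inr (b', β)) ≠ 0).card
      = ∑ b' ∈ univ.erase b, (univ.filter fun β : B => v (Sum.inr (b', β)) ≠ 0).card :=
    Finset.sum_congr rfl fun b' hb' => hoff b' (Finset.ne_of_mem_erase hb')
  rw [hsum]
  set S := nbrs H a with hS
  have hcol : ∀ (w : (A × A) ⊕ (B × B) → ZMod 2),
      (univ.filter fun β : B => w (Sum.inr (b, β)) ≠ 0).card
        = (S.filter fun β => w (Sum.inr (b, β)) ≠ 0).card
          + (Sᶜ.filter fun β => w (Sum.inr (b, β)) ≠ 0).card := by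
    intro w
    rw [← Finset.card_union_of_disjoint]
    · congr 1
      ext β
      simp only [Finset.mem_filter, Finset.mem_univ, true_and, Finset.mem_union, Finset.mem_compl]
      tauto
    · exact Finset.disjoint_filter_filter disjoint_compl_right
  rw [hcol (v + expanderHZ H (b, a)), hcol v]
  have hout : (Sᶜ.filter fun β => (v + expanderHZ H (b, a)) (Sum.inr (b, β)) ≠ 0)
      = Sᶜ.filter fun β => v (Sum.inr (b, β)) ≠ 0 := by
    refine Finset.filter_congr fun β hβ => ?_
    rw [Finset.mem_compl, hS, mem_nbrs, not_not] at hβ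
    rw [Pi.add_apply, expanderHZ_row_apply_inr, hβ, mul_zero, add_zero]
  rw [hout]
  have hin : (S.filter fun β => (v + expanderHZ H (b, a)) (Sum.inr (b, β)) ≠ 0)
      = S.filter fun β => ¬ (v (Sum.inr (b, β)) ≠ 0) := by
    refine Finset.filter_congr fun β hβ => ?_
    rw [hS, mem_nbrs] at hβ
    rw [Pi.add_apply, expanderHZ_row_apply_inr, if_pos rfl, one_mul, zmod2_eq_one_of_ne_zero hβ, not_not]
    constructor
    · intro h
      by_contra hv
      exact h (by rw [zmod2_eq_one_of_ne_zero hv]; decide)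
    · intro h; rw [h]; decide
  rw [hin]
  have hsplit := Finset.card_filter_add_card_filter_not (s := S) (fun β => v (Sum.inr (b, β)) ≠ 0)
  have hScard : S.card = dA := card_nbrs_eq H hreg a
  omega

/-- **Adding a generator changes the weighted size by `2Δ_AΔ_B − 2(Δ_A m_A + Δ_B m_B)`**, where
`m_A = |{α ∈ Γ(b) : αa ∈ E}|`, `m_B = |{β ∈ Γ(a) : bβ ∈ E}|` count the error qubits of the generator.
[cite: FawziGrospellierLeverrier2018, Lemma 24 proof ("x + y ≤ 1 because E_R minimizes ‖E_R‖"; arXiv v2 p0018 L81)] -/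
theorem wnorm_add_row (H : Matrix B A (ZMod 2)) {dA dB : ℕ} (hreg : IsBiregular H dA dB)
    (v : (A × A) ⊕ (B × B) → ZMod 2) (b : B) (a : A) :
    wnorm dA dB (v + expanderHZ H (b, a))
      + 2 * (dA * ((nbrs Hᵀ b).filter fun α => v (Sum.inl (α, a)) ≠ 0).card
        + dB * ((nbrs H a).filter fun β => v (Sum.inr (b, β)) ≠ 0).card)
      = wnorm dA dB v + 2 * (dA * dB) := by
  have hA := cardA_add_row H hreg v b a
  have hB := cardB_add_row H hreg v b a
  simp only [wnorm]
  nlinarith [hA, hB]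

omit [DecidableEq A] [DecidableEq B] in
/-- The weighted size dominates `Δ_A·|E|` and is dominated by `Δ_B·|E|` when `Δ_A ≤ Δ_B`
(FGL18 eq. "`d_A ‖E‖ ≤ |E| ≤ d_B ‖E‖`", multiplied by `d_A d_B`).
[cite: FawziGrospellierLeverrier2018, Lemma 24 proof eq. (norm prop) (arXiv v2 p0018 L46-48)] -/
theorem hammingNorm_le_wnorm (dA dB : ℕ) (hle : dA ≤ dB) (v : (A × A) ⊕ (B × B) → ZMod 2) :
    dA * hammingNorm v ≤ wnorm dA dB v ∧ wnorm dA dB v ≤ dB * hammingNorm v := by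
  have hsplit : hammingNorm v
      = (univ.filter fun p : A × A => v (Sum.inl p) ≠ 0).card
        + (univ.filter fun p : B × B => v (Sum.inr p) ≠ 0).card := by
    simp only [hammingNorm]
    rw [Finset.card_filter, Finset.card_filter, Finset.card_filter, Fintype.sum_sum_type]
  rw [hsplit, wnorm]
  constructor <;> nlinarith

/-- A `‖·‖`-minimal (weighted-size minimal) representative of the coset `e + C_Z^⊥` exists.
[cite: FawziGrospellierLeverrier2018, Lemma 24 proof ("Let E_R be the error of E + C_Z^⊥ which minimizes ‖E_R‖"; arXiv v2 p0018 L49)] -/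
theorem exists_wnorm_min {R Q : Type*} [Fintype R] [Fintype Q] [DecidableEq Q] (Hg : Matrix R Q (ZMod 2))
    (N : (Q → ZMod 2) → ℕ) (e : Q → ZMod 2) :
    ∃ eR : Q → ZMod 2, eR - e ∈ rowSpace Hg ∧ ∀ e' : Q → ZMod 2, e' - e ∈ rowSpace Hg → N eR ≤ N e' := by
  classical
  set S : Finset (Q → ZMod 2) := univ.filter fun e' => e' - e ∈ rowSpace Hg with hS
  have hne : S.Nonempty := ⟨e, by rw [hS, Finset.mem_filter]; exact ⟨Finset.mem_univ _, by simp⟩⟩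
  obtain ⟨eR, heR, hmin⟩ := Finset.exists_min_image S N hne
  rw [hS, Finset.mem_filter] at heR
  refine ⟨eR, heR.2, fun e' he' => hmin e' ?_⟩
  rw [hS, Finset.mem_filter]
  exact ⟨Finset.mem_univ _, he'⟩

/-- Vectors of `rowsp H_Z` have zero `σ_X`-syndrome (`H_X H_Zᵀ = 0`).
[cite: FawziGrospellierLeverrier2018, §2.3 (H_X H_Z^T = 0)] -/
theorem expanderHX_mulVec_eq_zero_of_mem_rowSpace (H : Matrix B A (ZMod 2))
    {v : (A × A) ⊕ (B × B) → ZMod 2} (hv : v ∈ rowSpace (expanderHZ H)) : expanderHX H *ᵥ v = 0 := by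
  rw [mem_rowSpace_iff] at hv
  obtain ⟨y, rfl⟩ := hv
  rw [← Matrix.mulVec_transpose, Matrix.mulVec_mulVec, expanderHX_mul_expanderHZ_transpose,
    Matrix.zero_mulVec]

/-- The elementary inequality behind FGL18 Lemma 24 ("the function analysis below shows that
`f(x,y) ≥ β/r`"): for `x, y ≥ 0` with `x + y ≤ 1` and any `s`,
`(s+½)² x + (s−½)² y ≥ xy` (the bilinear form attains its minimum `0` on the edge `x + y = 1` at
`x = ½ − s`). [cite: FawziGrospellierLeverrier2018, Lemma 24 proof, function analysis (arXiv v2 p0018 L99-130)] -/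
theorem triangle_ineq {x y s : ℝ} (hx : 0 ≤ x) (hy : 0 ≤ y) (hxy : x + y ≤ 1) :
    x * y ≤ (s + 1 / 2) ^ 2 * x + (s - 1 / 2) ^ 2 * y := by
  have key : (2 - x - y) * ((s + 1 / 2) ^ 2 * x + (s - 1 / 2) ^ 2 * y - x * y)
      = (1 - x - y) * ((s - 1 / 2) ^ 2 * y + (s + 1 / 2) ^ 2 * x)
        + x * (s + 1 / 2 - y) ^ 2 + y * (1 / 2 - x - s) ^ 2 := by ring
  have hpos : 0 < 2 - x - y := by linarith
  have hrhs : 0 ≤ (1 - x - y) * ((s - 1 / 2) ^ 2 * y + (s + 1 / 2) ^ 2 * x)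
        + x * (s + 1 / 2 - y) ^ 2 + y * (1 / 2 - x - s) ^ 2 := by
    have h1 : 0 ≤ 1 - x - y := by linarith
    positivity
  by_contra hlt
  push Not at hlt
  have : (2 - x - y) * ((s + 1 / 2) ^ 2 * x + (s - 1 / 2) ^ 2 * y - x * y) < 0 :=
    mul_neg_of_pos_of_neg hpos (by linarith)
  linarith

/-- **The arithmetic of FGL18 Lemma 24:** with `X = |x_a|`, `Y = |x_b|`, `za = |χ_a| ≤ 2δ_BΔ_B`,
`zb = |χ_b| ≤ 2δ_AΔ_A`, the reduced-cardinality constraint `Δ_A X + Δ_B Y ≤ Δ_AΔ_B` (`x + y ≤ 1`) and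
`Δ_A ≤ Δ_B`, the decrease bound `X(Δ_A − zb − Y) + (Δ_B − za − X)Y − X zb − za Y` is at least
`β₀ Δ_B (X + Y)`, `β₀ = (r/2)[1 − 4(δ_A + δ_B + (δ_B − δ_A)²)]`, `r = Δ_A/Δ_B`.
[cite: FawziGrospellierLeverrier2018, Lemma 24 proof (arXiv v2 p0018 L72-130) with Def 10] -/
theorem key_ineq {dA dB X Y za zb δA δB : ℝ} (hdA : 0 < dA) (hle : dA ≤ dB) (hX : 0 ≤ X) (hY : 0 ≤ Y)
    (hza : za ≤ 2 * δB * dB) (hzb : zb ≤ 2 * δA * dA) (hmin : dA * X + dB * Y ≤ dA * dB)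
    (hβ : 0 < (dA / dB) / 2 * (1 - 4 * (δA + δB + (δB - δA) ^ 2))) :
    (dA / dB) / 2 * (1 - 4 * (δA + δB + (δB - δA) ^ 2)) * dB * (X + Y)
      ≤ X * (dA - zb - Y) + (dB - za - X) * Y - X * zb - za * Y := by
  have hdB : 0 < dB := lt_of_lt_of_le hdA hle
  set c : ℝ := (1 - 4 * (δA + δB + (δB - δA) ^ 2)) / 2 with hc
  have hc0 : 0 < c := by
    have : 0 < dA / dB := div_pos hdA hdB
    rw [hc]
    have h2 : 0 < (1 - 4 * (δA + δB + (δB - δA) ^ 2)) := by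
      by_contra hneg
      push Not at hneg
      have : (dA / dB) / 2 * (1 - 4 * (δA + δB + (δB - δA) ^ 2)) ≤ 0 :=
        mul_nonpos_of_nonneg_of_nonpos (by positivity) hneg
      linarith
    linarith
  -- normalized variables
  set x : ℝ := X / dB with hx
  set y : ℝ := Y / dA with hy
  have hXe : X = dB * x := by rw [hx]; field_simp
  have hYe : Y = dA * y := by rw [hy]; field_simp
  have hx0 : 0 ≤ x := by rw [hx]; positivity
  have hy0 : 0 ≤ y := by rw [hy]; positivity
  have hxy : x + y ≤ 1 := by
    rw [hXe, hYe] at hmin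
    have hprod : dA * dB * (x + y) ≤ dA * dB * 1 := by nlinarith
    have hpos : 0 < dA * dB := by positivity
    by_contra hlt
    push Not at hlt
    have := mul_lt_mul_of_pos_left hlt hpos
    linarith
  -- step 1: drop the `χ` terms using their bounds
  have hstep1 : X * (dA - zb - Y) + (dB - za - X) * Y - X * zb - za * Y
      ≥ dA * dB * (x * (1 - 4 * δA) + y * (1 - 4 * δB) - 2 * x * y) := by
    rw [hXe, hYe]
    have h1 : dB * x * zb ≤ dB * x * (2 * δA * dA) :=
      mul_le_mul_of_nonneg_left hzb (by positivity)
    have h2 : za * (dA * y) ≤ (2 * δB * dB) * (dA * y) :=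
      mul_le_mul_of_nonneg_right hza (by positivity)
    nlinarith
  -- step 2: the triangle inequality with `s = δB − δA`
  have htri := triangle_ineq (s := δB - δA) hx0 hy0 hxy
  have hstep2 : x * (1 - 4 * δA) + y * (1 - 4 * δB) - 2 * x * y ≥ c * (x + y) := by
    have hu : 1 - 4 * δA - c = 2 * (δB - δA + 1 / 2) ^ 2 := by rw [hc]; ring
    have hv : 1 - 4 * δB - c = 2 * (δB - δA - 1 / 2) ^ 2 := by rw [hc]; ring
    nlinarith
  -- step 3: `dA dB c (x + y) = c dB (X + (dB/dA) Y) ≥ c dB (X + Y)`? — here `β₀ dB = dA c`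
  have hβc : (dA / dB) / 2 * (1 - 4 * (δA + δB + (δB - δA) ^ 2)) * dB = dA * c := by
    rw [hc]; field_simp
  rw [hβc]
  have hstep3 : dA * dB * (c * (x + y)) ≥ dA * c * (X + Y) := by
    rw [hXe, hYe]
    have : dA * c * (dB * x + dA * y) ≤ dA * c * (dB * x + dB * y) := by
      apply mul_le_mul_of_nonneg_left _ (by positivity)
      nlinarith
    nlinarith
  have hmono : dA * dB * (c * (x + y)) ≤ dA * dB * (x * (1 - 4 * δA) + y * (1 - 4 * δB) - 2 * x * y) :=
    mul_le_mul_of_nonneg_left hstep2 (by positivity)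
  linarith

end ReducedCardinality


end QuantumExpander

end Literature.InformationTheory.QuantumCodes
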